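import Literature.Barriers.CriticalPhenomena.SupercriticalSAWSpaceFillingDensityNecessary
import HarnessLib

/-!
# Barrier mechanism, nineteenth audit: the VOLUME window `|x(δ) - x_c| = O(δ²)` is equivalent
# to the sub-problem — the boundary of the sub-volume class, decided by the zero density that an
# SLE_κ (`κ ≤ 4`) limit forces

Barrier catalogue `Literature/Barriers/CriticalPhenomena/` (D-0021); companion of
`SupercriticalSAWSpaceFillingProofs` (nineteenth audit, 2026-08-16, refuter, "barrier-audit"
gen 19, of the mechanism file `…Proofs` of `SupercriticalSAWSpaceFilling` = Theorem 1 of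
H. Duminil-Copin, G. Kozma, A. Yadin, *Supercritical self-avoiding walks are space-filling*,
Ann. IHP Probab. Stat. 50 (2014) 315–326, arXiv:1110.3074 — PROVED in the tree,
`SupercriticalSAWSpaceFilling_holds`; `blocks:` line unconditional,
`SupercriticalSAW.not_robustSAWScalingLimit`).

## What the audit found

1. **Page level (confirming).** arXiv:1110.3074 re-read: p. 2 (§1, the weak sense "for any
   open set `U ⊂ Ω`, `P_{(Ω_δ,a_δ,b_δ,x)}[γ_δ ∩ U = ∅] → 0`"; Theorem 1 verbatim), p. 7 (proof of
   Theorem 1: "connected set `S` of cardinality `s` … at least `s/(2m+1)²` boxes …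
   `≤ C(x,m,Ω) δ⁻² 2^{-s/(2m+1)²}`"), p. 8 (§4: "very little additional information", Problems
   9–10, Conjecture 11 for the hexagonal lattice). Forward citations: 27 in the local graph, 2
   since 2023 on an API refresh (newest Ann. Probab. 54 (2026), arXiv:2310.17299, AT `x_c`);
   zbMATH "self-avoiding walk" 2025–2026: 38 items (dense-walk Monte Carlo, high-dimensional
   crossover and deconvolution, cubic graphs, pulled polymers, quantitative sub-ballisticity) —
   none on supercritical planar scaling limits or on Problem 10; the hub's hybrid index and the
   internal galaxy corpora return nothing beyond the held texts. Nothing evades the barrier.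
2. **The window clause has a decidable boundary case (this file, proved).** The catalogue
   (`…Narrow`, gen 1; `…WindowRate`, gen 15) reads: windows `w(δ) ≥ δ^θ`, `θ < 1/6`, are
   BLOCKED; windows `0 ≤ w(δ) = o(δ²)` are EQUIVALENT to the sub-problem
   (`SupercriticalSAW.windowRobustSAWScalingLimit_iff`: there the tilt `(x(δ)/x_c)^{|γ_δ|}` tends
   to `1` UNIFORMLY, `|Ω_δ| |log x(δ) - log x_c| → 0`); "the windows in between (`δ² ≲ w(δ) ≲
   δ^{1/6}`) are decided by no theorem", with the gen-9 remark that `O(δ²)` windows transfer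
   null / full-measure conclusions (bounded Radon–Nikodym factors). The boundary case
   `w(δ) ≍ δ²` — where the tilt is bounded above and below but does NOT tend to `1` uniformly —
   is decided here for the SLE identification itself, on the free side:
   **`WindowRobustSAWScalingLimit (δ ↦ C δ²) ↔ SAWScalingLimit` for every `C ≥ 0`**
   (`windowRobustSAWScalingLimit_sq_iff`), and `SAWScalingLimitAlong X ↔ SAWScalingLimit` for
   every volume schedule `|X(δ) - x_c| = O(δ²)` (`sawScalingLimitAlong_iff_of_isVolumeSchedule`);
   in particular the sub-problem is INVARIANT under `x_c ↦ x_c + s δ²` for every fixed real `s`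
   (`sawScalingLimit_iff_along_add_mul_sq`): a bounded multiple of the density `δ²|γ_δ|` in the
   Hamiltonian is free. The input replacing uniform smallness is the ZERO DENSITY that an SLE_κ
   limit with `κ ≤ 4` forces on whichever side converges (`…DensityNecessary`,
   `tendsto_measure_density_of_convergesInLawToSLE`: disjoint mesh squares, closed-set
   portmanteau, zero area of the SLE trace [RS05, Thm 8.1]): on the walks with `δ²|γ_δ| < ρ` the
   tilt is within `e^{O(ρ)} - 1` of `1`, the others have probability `→ 0`, and
   `|∫ g dP_y - ∫ g dP_x| ≤ 2M e^{Nt}((e^{Lt} - 1) + e^{Nt} P_x[|γ| ≥ L])`, `t = |log y - log x|`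
   (`abs_integral_lawAt_sub_le_of_length`, from the change-of-measure identity
   `∫ g dP_y = E_x[(y/x)^{|γ|} g]/E_x[(y/x)^{|γ|}]`, `integral_lawAt_eq_div`). The gen-9 remark is
   made a declaration on the way (`exists_eventually_lawAt_le_smul_of_volumeClose`,
   `isSpaceFillingLaws_iff_of_volumeClose`: weak space-filling, hence Problem 10, is the same
   statement at `x_c` and at `x_c + s δ²`). What stays undecided is `δ² ≪ w(δ) ≲ δ^{1/6}`: for
   `w(δ)/δ² → ∞` the tilt `e^{(w/δ²)·δ²|γ_δ|}` is an indeterminate `∞ · 0` without a RATE for the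
   zero density, which the sub-problem alone does not supply (sup-norm convergence to a curve of
   dimension `4/3` confines `γ_δ` to an `ε(δ)`-tube of `≍ ε^{2/3} δ⁻²` sites with `ε(δ) → 0` at
   an unknown rate); in substance the transfer is expected up to the crossover `δ^{4/3}`
   [LSW04, Prediction 2].
3. **A bookkeeping remark on the blocked side (formalised in part B,
   `SupercriticalSAWSpaceFillingWindowRateQuarter`).** The exponent `1/6` of
   `…WindowRate` applies the effective Theorem 6 at hole size `s = r/δ` (the digital segment of
   `SupercriticalSAW.hasLargeHole_of_forall_notMem_ball`), whereas the printed Peierls bound is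
   in the site-cardinality `s` of the hole (p. 7) and an avoided ball `B(z, r)` leaves
   `≍ (r/δ)²` sites in ONE component of `𝔻_δ ∖ Γ_δ^ξ` once `ξδ < r/2` (a digital square, rows
   joined through a column); with the quadratic count the rate term `r² δ^{4θ-2}/(1600A²)` beats
   the prefactor `e^{200 A δ^{-2θ}}` iff `θ < 1/3`, and the binding constraint becomes the tree's
   mesh threshold `δ < (9m + 75)⁻²` of the tile construction (`SupercriticalSAW.meshThreshold_le`,
   from `isDeep_holeBox`), i.e. `θ < 1/4` — so "improving `1/6` needs a better span/length
   trade-off or a sharper per-box gain" (`…WindowRate`, `evasions_known`) omits the cheapest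
   lever. Proved in the part-B companion (`SupercriticalSAWSpaceFillingWindowRateQuarter_holds`:
   every window `w(δ) ≥ δ^θ`, `θ < 1/4`, is blocked); it changes no planner-facing conclusion
   (the in-substance threshold is `δ^{4/3}`).

Outcome: **CONFIRMED at page level; the window clause is sharpened at its lower edge by a
declaration** (`SupercriticalSAWSpaceFillingVolumeWindow_holds`, axioms `propext`,
`Classical.choice`, `Quot.sound`). No evasion found.

## Formal content (all proved)

`fugacityTilt`, `weightAt_eq_withDensity_fugacityTilt` (`W_y = W_x` with density `(y/x)^{|γ|}`),
`lawAt_eq_zero_of_lawAt_eq_zero` (junk cases agree), `integral_lawAt_eq_div` (change of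
measure), `abs_integral_lawAt_sub_le_of_length` (the core inequality),
`abs_log_sub_log_le_div`, `eventually_volumeClose_bounds`, `tendsto_integral_lawAt_sub_of_density`
(transfer under zero density), `exists_eventually_lawAt_le_smul_of_volumeClose`,
`tendsto_lawAt_zero_of_volumeClose`, `isSpaceFillingLaws_iff_of_volumeClose`,
`isSpaceFillingFamily_add_mul_sq_iff`, `ConvergesInLawToSLE.of_volumeClose` (`0 < κ ≤ 4`),
`IsVolumeSchedule` (+ `_const`, `_add_mul_sq`, `_of_window`, `IsSubVolumeSchedule.isVolumeSchedule`,
`exists_nonneg`), `convergesInLawToSLE_volume_iff`, `sawScalingLimitAlong_iff_of_isVolumeSchedule`,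
`windowRobustSAWScalingLimit_iff_of_le_sq`, `windowRobustSAWScalingLimit_sq_iff`,
`sawScalingLimit_iff_along_add_mul_sq`; the closed `Prop` `SupercriticalSAWSpaceFillingVolumeWindow`
with `…_holds`.

Mathlib: `MeasureTheory.withDensity_apply`, `lintegral_sum_measure`, `lintegral_dirac'`,
`integral_withDensity_eq_integral_smul`, `lintegral_coe_eq_integral`, `integral_smul_measure`,
`abs_integral_le_integral_abs`, `integral_indicator_one`, `Real.log_le_sub_one_of_pos`,
`ENNReal.Tendsto.const_mul`, `Metric.tendsto_nhds`.

## References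

* H. Duminil-Copin, G. Kozma, A. Yadin, Ann. IHP Probab. Stat. 50 (2014) 315–326,
  arXiv:1110.3074: p. 2 (§1: the law `P_{(Ω_δ,a_δ,b_δ,x)}`, the weak sense of space-filling;
  Theorem 1), p. 7 (proof of Theorem 1: hole cardinality `s`, `≥ s/(2m+1)²` boxes), p. 8
  (Problems 9–10, Conjecture 11). [DuminilCopinKozmaYadin2014]
* G. F. Lawler, O. Schramm, W. Werner, *On the scaling limit of planar self-avoiding walk*
  (2004), arXiv:math/0204277, Prediction 2 (`ν = 3/4`; crossover `δ^{4/3}`). [LawlerSchrammWerner2004SAW]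
* S. Rohde, O. Schramm, *Basic properties of SLE*, Ann. Math. 161 (2005), Thm 8.1 (zero area
  of the trace, `κ < 8`). [RohdeSchramm2005]
* P. Billingsley, *Convergence of probability measures*, 2nd ed. (1999), Thm 2.1. [Billingsley1999]
-/

noncomputable section

open MeasureTheory Filter Topology Metric Set Literature.Probability.LatticeModels
  Literature.Probability.Percolation Literature.Probability.RandomPlanarGeometry
  Literature.Probability.RandomPlanarGeometry.SAW
open scoped ENNReal NNReal BoundedContinuousFunction

namespace Literature.Barriers.CriticalPhenomena

namespace SupercriticalSAW

/-! ### The fugacity tilt `(y/x)^{|γ|}`: the law at `y` is the law at `x` reweighted -/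

section Tilt

variable {Ω : Set ℂ} {δ : ℝ} {a b : Site 2}

/-- The fugacity tilt `(y/x)^{|γ|}` (the Radon–Nikodym factor between the weights `y^{|γ|}` and
`x^{|γ|}`), as an `ℝ≥0`-valued function. [folklore] -/
def fugacityTilt (x y : ℝ) (γ : DomainSAW Ω δ a b) : ℝ≥0 :=
  Real.toNNReal ((y / x) ^ γ.length)

/-- The tilt as a real number. [folklore] -/
theorem coe_fugacityTilt {x y : ℝ} (hx : 0 < x) (hy : 0 < y) (γ : DomainSAW Ω δ a b) :
    ((fugacityTilt x y γ : ℝ≥0) : ℝ) = (y / x) ^ γ.length :=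
  Real.coe_toNNReal _ (pow_nonneg (div_pos hy hx).le _)

/-- The tilt in `ℝ≥0∞`. [folklore] -/
theorem coe_fugacityTilt_ennreal (x y : ℝ) (γ : DomainSAW Ω δ a b) :
    ((fugacityTilt x y γ : ℝ≥0) : ℝ≥0∞) = ENNReal.ofReal ((y / x) ^ γ.length) := rfl

/-- `xⁿ (y/x)ⁿ = yⁿ` (`x ≠ 0`). [folklore] -/
theorem pow_mul_div_pow_eq {x : ℝ} (hx : x ≠ 0) (y : ℝ) (n : ℕ) : x ^ n * (y / x) ^ n = y ^ n := by
  rw [← mul_pow, mul_div_cancel₀ _ hx]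

/-- **The weights at fugacity `y` are the weights at fugacity `x` with density `(y/x)^{|γ|}`.**
[cite: DuminilCopinKozmaYadin2014, §1 (definition of P_{(Ω_δ,a_δ,b_δ,x)})] -/
theorem weightAt_eq_withDensity_fugacityTilt {x : ℝ} (hx : 0 < x) (y : ℝ) :
    weightAt y Ω δ a b = (weightAt x Ω δ a b).withDensity fun γ => fugacityTilt x y γ := by
  ext s hs
  rw [withDensity_apply _ hs, ← lintegral_indicator hs, weightAt, weightAt, Measure.sum_apply _ hs,
    lintegral_sum_measure]
  refine tsum_congr fun γ => ?_
  rw [Measure.smul_apply, Measure.dirac_apply' _ hs, smul_eq_mul, lintegral_smul_measure,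
    lintegral_dirac' _ (DomainSAW.measurable_of_top _)]
  by_cases h : γ ∈ s
  · simp only [indicator_of_mem h, Pi.one_apply, mul_one, smul_eq_mul, coe_fugacityTilt_ennreal]
    rw [← ENNReal.ofReal_mul (pow_nonneg hx.le _), pow_mul_div_pow_eq hx.ne']
  · simp only [indicator_of_notMem h, mul_zero, smul_zero]

/-- The tilt is `exp(|γ| (log y - log x))`. [folklore] -/
theorem coe_fugacityTilt_eq_exp {x y : ℝ} (hx : 0 < x) (hy : 0 < y) (γ : DomainSAW Ω δ a b) :
    ((fugacityTilt x y γ : ℝ≥0) : ℝ) = Real.exp (γ.length * (Real.log y - Real.log x)) := by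
  rw [coe_fugacityTilt hx hy, ← Real.log_div hy.ne' hx.ne', Real.exp_nat_mul,
    Real.exp_log (div_pos hy hx)]

/-- `|eᵘ - 1| ≤ eˢ - 1` for `|u| ≤ s`. [folklore] -/
theorem abs_exp_sub_one_le {u s : ℝ} (h : |u| ≤ s) : |Real.exp u - 1| ≤ Real.exp s - 1 := by
  obtain ⟨h₁, h₂⟩ := abs_le.1 h
  rw [abs_le]
  constructor
  · -- `1 - eᵘ ≤ 1 - e⁻ˢ ≤ eˢ - 1`
    have h3 : Real.exp (-s) ≤ Real.exp u := Real.exp_le_exp.2 h₁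
    have h4 : 2 ≤ Real.exp s + Real.exp (-s) := by
      have := Real.add_one_le_exp s
      have := Real.add_one_le_exp (-s)
      nlinarith [Real.exp_pos s, Real.exp_pos (-s), Real.exp_neg s,
        mul_pos (Real.exp_pos s) (Real.exp_pos (-s))]
    linarith
  · linarith [Real.exp_le_exp.2 h₂]

/-- **Pointwise bounds on the tilt.** If `|γ| ≤ N` then `e^{-N t} ≤ (y/x)^{|γ|} ≤ e^{N t}`,
`t = |log y - log x|`. [folklore] -/
theorem exp_neg_le_fugacityTilt {x y : ℝ} (hx : 0 < x) (hy : 0 < y) {N : ℕ} {γ : DomainSAW Ω δ a b}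
    (hγ : γ.length ≤ N) :
    Real.exp (-(N * |Real.log y - Real.log x|)) ≤ (fugacityTilt x y γ : ℝ) ∧
      ((fugacityTilt x y γ : ℝ≥0) : ℝ) ≤ Real.exp (N * |Real.log y - Real.log x|) := by
  rw [coe_fugacityTilt_eq_exp hx hy, Real.exp_le_exp, Real.exp_le_exp]
  have hn : (γ.length : ℝ) ≤ N := by exact_mod_cast hγ
  have hn0 : (0 : ℝ) ≤ γ.length := Nat.cast_nonneg _
  have ha := abs_le.1 (show |(γ.length : ℝ) * (Real.log y - Real.log x)| ≤ N * |Real.log y - Real.log x| by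
    rw [abs_mul, abs_of_nonneg hn0]
    exact mul_le_mul_of_nonneg_right hn (abs_nonneg _))
  exact ⟨ha.1, ha.2⟩

/-- **The tilt is close to `1` on short walks**: if `|γ| ≤ L` (`L` real) then
`|(y/x)^{|γ|} - 1| ≤ e^{L t} - 1`, `t = |log y - log x|`. [folklore] -/
theorem abs_fugacityTilt_sub_one_le {x y : ℝ} (hx : 0 < x) (hy : 0 < y) {L : ℝ}
    {γ : DomainSAW Ω δ a b} (hγ : (γ.length : ℝ) ≤ L) :
    |((fugacityTilt x y γ : ℝ≥0) : ℝ) - 1| ≤ Real.exp (L * |Real.log y - Real.log x|) - 1 := by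
  rw [coe_fugacityTilt_eq_exp hx hy]
  refine abs_exp_sub_one_le ?_
  rw [abs_mul, abs_of_nonneg (Nat.cast_nonneg _)]
  exact mul_le_mul_of_nonneg_right hγ (abs_nonneg _)

/-- On every walk of length `≤ N`: `|(y/x)^{|γ|} - 1| ≤ e^{N t}`. [folklore] -/
theorem abs_fugacityTilt_sub_one_le_exp {x y : ℝ} (hx : 0 < x) (hy : 0 < y) {N : ℕ}
    {γ : DomainSAW Ω δ a b} (hγ : γ.length ≤ N) :
    |((fugacityTilt x y γ : ℝ≥0) : ℝ) - 1| ≤ Real.exp (N * |Real.log y - Real.log x|) := by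
  obtain ⟨h₁, h₂⟩ := exp_neg_le_fugacityTilt hx hy hγ
  have h0 : 0 < ((fugacityTilt x y γ : ℝ≥0) : ℝ) := (Real.exp_pos _).trans_le h₁
  have h1 : (1 : ℝ) ≤ Real.exp (N * |Real.log y - Real.log x|) := Real.one_le_exp (by positivity)
  rw [abs_le]
  constructor <;> linarith

end Tilt

/-! ### Integrals at fugacity `y` as tilted integrals at fugacity `x` -/

section Integrals

variable {Ω : Set ℂ} {δ : ℝ} {a b : Site 2}

/-- If `P_{(Ω_δ,a,b,x)} = Z⁻¹ · W` is a probability measure then `0 < Z < ∞`. [folklore] -/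
theorem weightAt_univ_ne_zero_and_ne_top {x : ℝ} (h : IsProbabilityMeasure (lawAt x Ω δ a b)) :
    weightAt x Ω δ a b univ ≠ 0 ∧ weightAt x Ω δ a b univ ≠ ∞ := by
  have h1 : lawAt x Ω δ a b univ = 1 := measure_univ
  rw [lawAt, Measure.smul_apply, smul_eq_mul] at h1
  constructor
  · intro h0; rw [h0, mul_zero] at h1; exact zero_ne_one h1
  · intro ht; rw [ht, ENNReal.inv_top, zero_mul] at h1; exact zero_ne_one h1

/-- `W_x = Z_x · P_x` when `P_x` is a probability measure. [folklore] -/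
theorem weightAt_eq_smul_lawAt {x : ℝ} (h : IsProbabilityMeasure (lawAt x Ω δ a b)) :
    weightAt x Ω δ a b = weightAt x Ω δ a b univ • lawAt x Ω δ a b := by
  obtain ⟨h0, ht⟩ := weightAt_univ_ne_zero_and_ne_top h
  rw [lawAt, smul_smul, ENNReal.mul_inv_cancel h0 ht, one_smul]

/-- A bounded function is integrable against the (finite) fugacity-`x` law. [folklore] -/
theorem integrable_lawAt_of_abs_le (x : ℝ) (g : DomainSAW Ω δ a b → ℝ) {M : ℝ} (hM : ∀ γ, |g γ| ≤ M) :
    Integrable g (lawAt x Ω δ a b) :=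
  Integrable.of_bound (DomainSAW.measurable_of_top g).aestronglyMeasurable M
    (ae_of_all _ fun γ => by rw [Real.norm_eq_abs]; exact hM γ)

/-- **If the law at one positive fugacity is the zero (junk) measure, so is the law at every
other positive fugacity** (same support; bounded lengths): no walk at all, or infinite mass for
both. [folklore] -/
theorem lawAt_eq_zero_of_lawAt_eq_zero {x y : ℝ} (hx : 0 < x) (hy : 0 < y) {N : ℕ}
    (hN : ∀ γ : DomainSAW Ω δ a b, γ.length ≤ N) (h0 : lawAt x Ω δ a b = 0) :
    lawAt y Ω δ a b = 0 := by
  set K := ENNReal.ofReal (Real.exp (N * |Real.log y - Real.log x|)) with hK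
  set K' := ENNReal.ofReal (Real.exp (N * |Real.log x - Real.log y|)) with hK'
  have hyx : weightAt y Ω δ a b univ ≤ K * weightAt x Ω δ a b univ := by
    have := Measure.le_iff'.1 (weightAt_le_smul_weightAt (Ω := Ω) (δ := δ) (a := a) (b := b) hx hy hN) univ
    rwa [Measure.smul_apply, smul_eq_mul] at this
  have hxy : weightAt x Ω δ a b univ ≤ K' * weightAt y Ω δ a b univ := by
    have := Measure.le_iff'.1 (weightAt_le_smul_weightAt (Ω := Ω) (δ := δ) (a := a) (b := b) hy hx hN) univ
    rwa [Measure.smul_apply, smul_eq_mul] at this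
  -- `Z_x = 0` or `Z_x = ∞`
  have hZ : weightAt x Ω δ a b univ = 0 ∨ weightAt x Ω δ a b univ = ∞ := by
    by_contra hne
    have hne0 : weightAt x Ω δ a b univ ≠ 0 := fun h => hne (Or.inl h)
    have hnet : weightAt x Ω δ a b univ ≠ ∞ := fun h => hne (Or.inr h)
    have h1 : lawAt x Ω δ a b univ = 1 := by
      rw [lawAt, Measure.smul_apply, smul_eq_mul, ENNReal.inv_mul_cancel hne0 hnet]
    rw [h0, Measure.coe_zero, Pi.zero_apply] at h1
    exact zero_ne_one h1
  rcases hZ with hZ0 | hZtop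
  · have hy0 : weightAt y Ω δ a b univ = 0 := by
      rw [hZ0, mul_zero] at hyx
      exact le_antisymm hyx bot_le
    rw [lawAt, Measure.measure_univ_eq_zero.1 hy0, smul_zero]
  · have hytop : weightAt y Ω δ a b univ = ∞ := by
      rw [hZtop, top_le_iff] at hxy
      exact (ENNReal.mul_eq_top.1 hxy).elim (fun h => h.2) fun h => absurd h.1 ENNReal.ofReal_ne_top
    rw [lawAt, hytop, ENNReal.inv_top, zero_smul]

/-- **Change of fugacity as a change of measure.** If `P_x = P_{(Ω_δ,a,b,x)}` is a probability
measure (and the walks have bounded length), then for every bounded `g`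
`∫ g dP_y = ∫ (y/x)^{|γ|} g dP_x / ∫ (y/x)^{|γ|} dP_x`, i.e. `Z(y)/Z(x) = E_x[(y/x)^{|γ|}]` and
`P_y` is `P_x` tilted by `(y/x)^{|γ|}`. [cite: DuminilCopinKozmaYadin2014, §1 (definition of P_{(Ω_δ,a_δ,b_δ,x)})] -/
theorem integral_lawAt_eq_div {x y : ℝ} (hx : 0 < x) (hy : 0 < y)
    (hP : IsProbabilityMeasure (lawAt x Ω δ a b)) {N : ℕ} (hN : ∀ γ : DomainSAW Ω δ a b, γ.length ≤ N)
    (g : DomainSAW Ω δ a b → ℝ) :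
    ∫ γ, g γ ∂lawAt y Ω δ a b =
      (∫ γ, (fugacityTilt x y γ : ℝ) * g γ ∂lawAt x Ω δ a b) /
        ∫ γ, (fugacityTilt x y γ : ℝ) ∂lawAt x Ω δ a b := by
  haveI := hP
  set P := lawAt x Ω δ a b with hPdef
  set t := |Real.log y - Real.log x| with ht
  obtain ⟨hZ0, hZtop⟩ := weightAt_univ_ne_zero_and_ne_top hP
  have hW : weightAt x Ω δ a b = weightAt x Ω δ a b univ • P := weightAt_eq_smul_lawAt hP
  have hρmeas : Measurable (fugacityTilt (Ω := Ω) (δ := δ) (a := a) (b := b) x y) :=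
    DomainSAW.measurable_of_top _
  have hρge : ∀ γ : DomainSAW Ω δ a b, Real.exp (-(N * t)) ≤ (fugacityTilt x y γ : ℝ) := fun γ =>
    (exp_neg_le_fugacityTilt hx hy (hN γ)).1
  have hρle : ∀ γ : DomainSAW Ω δ a b, ((fugacityTilt x y γ : ℝ≥0) : ℝ) ≤ Real.exp (N * t) := fun γ =>
    (exp_neg_le_fugacityTilt hx hy (hN γ)).2
  have hint : Integrable (fun γ => (fugacityTilt x y γ : ℝ)) P :=
    integrable_lawAt_of_abs_le x _ fun γ => by
      rw [abs_of_nonneg (fugacityTilt x y γ).coe_nonneg]; exact hρle γ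
  have hI0 : Real.exp (-(N * t)) ≤ ∫ γ, (fugacityTilt x y γ : ℝ) ∂P := by
    have := integral_mono (integrable_const _) hint hρge
    simpa using this
  have hI0pos : 0 < ∫ γ, (fugacityTilt x y γ : ℝ) ∂P := (Real.exp_pos _).trans_le hI0
  have hWy : weightAt y Ω δ a b = (weightAt x Ω δ a b).withDensity fun γ => fugacityTilt x y γ :=
    weightAt_eq_withDensity_fugacityTilt hx y
  have hZy : weightAt y Ω δ a b univ =
      weightAt x Ω δ a b univ * ENNReal.ofReal (∫ γ, (fugacityTilt x y γ : ℝ) ∂P) := by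
    rw [hWy, withDensity_apply _ MeasurableSet.univ, Measure.restrict_univ, hW, lintegral_smul_measure,
      smul_eq_mul, lintegral_coe_eq_integral _ hint, Measure.smul_apply, smul_eq_mul,
      show P univ = 1 from measure_univ, mul_one]
  have hZr : (weightAt x Ω δ a b univ).toReal ≠ 0 := ENNReal.toReal_ne_zero.2 ⟨hZ0, hZtop⟩
  rw [lawAt, hZy, integral_smul_measure, hWy, integral_withDensity_eq_integral_smul hρmeas, hW,
    integral_smul_measure]
  simp only [NNReal.smul_def, smul_eq_mul, Measure.smul_apply, show P univ = 1 from measure_univ,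
    mul_one]
  rw [ENNReal.toReal_inv, ENNReal.toReal_mul, ENNReal.toReal_ofReal hI0pos.le]
  field_simp

/-- **The laws at two fugacities are close when the walks are short where it matters.** For
`x, y > 0`, walks of length `≤ N`, a real threshold `L` and `g` bounded by `M ≥ 0`:
`|∫ g dP_y - ∫ g dP_x| ≤ 2M e^{Nt} ((e^{Lt} - 1) + e^{Nt} P_x[|γ| ≥ L])`, `t = |log y - log x|`.
The point, compared with the two-sided domination bound `2M(e^{2Nt} - 1)` of `…Narrow`
(`abs_integral_lawAt_sub_le`), is that `N t` need only be BOUNDED, provided the walks longer than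
`L`, `L t` small, are rare. Proof: `P_y = P_x` tilted by `ρ = (y/x)^{|γ|}`
(`integral_lawAt_eq_div`), `∫ g dP_y - ∫ g dP_x = E_x[g(ρ - E_x ρ)]/E_x ρ`, `E_x ρ ≥ e^{-Nt}`,
`E_x|ρ - 1| ≤ (e^{Lt} - 1) + e^{Nt} P_x[|γ| ≥ L]`. [folklore] -/
theorem abs_integral_lawAt_sub_le_of_length {x y : ℝ} (hx : 0 < x) (hy : 0 < y) {N : ℕ}
    (hN : ∀ γ : DomainSAW Ω δ a b, γ.length ≤ N) {L : ℝ} (hL : 0 ≤ L) (g : DomainSAW Ω δ a b → ℝ)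
    {M : ℝ} (hM0 : 0 ≤ M) (hM : ∀ γ, |g γ| ≤ M) :
    |∫ γ, g γ ∂lawAt y Ω δ a b - ∫ γ, g γ ∂lawAt x Ω δ a b| ≤
      2 * M * Real.exp (N * |Real.log y - Real.log x|) *
        ((Real.exp (L * |Real.log y - Real.log x|) - 1) +
          Real.exp (N * |Real.log y - Real.log x|) *
            (lawAt x Ω δ a b {γ | L ≤ (γ.length : ℝ)}).toReal) := by
  set t := |Real.log y - Real.log x| with ht
  have ht0 : 0 ≤ t := abs_nonneg _
  have hL1 : 0 ≤ Real.exp (L * t) - 1 := by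
    have := Real.one_le_exp (mul_nonneg hL ht0)
    linarith
  have hRHS0 : 0 ≤ 2 * M * Real.exp (N * t) *
      ((Real.exp (L * t) - 1) + Real.exp (N * t) * (lawAt x Ω δ a b {γ | L ≤ (γ.length : ℝ)}).toReal) := by
    positivity
  rcases lawAt_eq_zero_or_isProbabilityMeasure x Ω δ a b with h0 | hP
  · -- junk: both laws vanish
    rw [lawAt_eq_zero_of_lawAt_eq_zero hx hy hN h0, h0]
    simp only [integral_zero_measure, sub_self, abs_zero, Measure.coe_zero, Pi.zero_apply,
      ENNReal.toReal_zero, mul_zero, add_zero]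
    exact mul_nonneg (by positivity) hL1
  haveI := hP
  set P := lawAt x Ω δ a b with hPdef
  set ρ : DomainSAW Ω δ a b → ℝ := fun γ => (fugacityTilt x y γ : ℝ) with hρ
  -- pointwise facts
  have hρge : ∀ γ, Real.exp (-(N * t)) ≤ ρ γ := fun γ => (exp_neg_le_fugacityTilt hx hy (hN γ)).1
  have hρle : ∀ γ, ρ γ ≤ Real.exp (N * t) := fun γ => (exp_neg_le_fugacityTilt hx hy (hN γ)).2
  have hρabs : ∀ γ, |ρ γ - 1| ≤ Real.exp (N * t) := fun γ => abs_fugacityTilt_sub_one_le_exp hx hy (hN γ)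
  set B : Set (DomainSAW Ω δ a b) := {γ | L ≤ (γ.length : ℝ)} with hB
  have hρ1 : ∀ γ, |ρ γ - 1| ≤ (Real.exp (L * t) - 1) + Real.exp (N * t) * B.indicator 1 γ := by
    intro γ
    by_cases hγ : γ ∈ B
    · rw [indicator_of_mem hγ, Pi.one_apply, mul_one]
      linarith [hρabs γ]
    · rw [indicator_of_notMem hγ, mul_zero, add_zero]
      have hγ' : (γ.length : ℝ) ≤ L := (not_le.1 hγ).le
      exact abs_fugacityTilt_sub_one_le hx hy hγ'
  -- integrability
  have hint_ρ : Integrable ρ P := integrable_lawAt_of_abs_le x ρ fun γ => by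
    simp only [hρ]; rw [abs_of_nonneg (fugacityTilt x y γ).coe_nonneg]; exact hρle γ
  have hint_g : Integrable g P := integrable_lawAt_of_abs_le x g hM
  have hint_ρg : Integrable (fun γ => ρ γ * g γ) P :=
    integrable_lawAt_of_abs_le x _ (M := Real.exp (N * t) * M) fun γ => by
      rw [abs_mul]
      simp only [hρ]
      rw [abs_of_nonneg (fugacityTilt x y γ).coe_nonneg]
      exact mul_le_mul (hρle γ) (hM γ) (abs_nonneg _) (Real.exp_pos _).le
  have hint_ρ1 : Integrable (fun γ => |ρ γ - 1|) P :=
    integrable_lawAt_of_abs_le x _ (M := Real.exp (N * t)) fun γ => by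
      rw [abs_abs]; exact hρabs γ
  have hint_d : Integrable (fun γ => (ρ γ - 1) * g γ) P :=
    integrable_lawAt_of_abs_le x _ (M := Real.exp (N * t) * M) fun γ => by
      rw [abs_mul]
      exact mul_le_mul (hρabs γ) (hM γ) (abs_nonneg _) (Real.exp_pos _).le
  have hint_d' : Integrable (fun γ => ρ γ - 1) P := hint_ρ.sub (integrable_const 1)
  -- the three integrals
  set I0 := ∫ γ, ρ γ ∂P with hI0def
  set I1 := ∫ γ, ρ γ * g γ ∂P with hI1def
  set J := ∫ γ, g γ ∂P with hJdef
  have hI0 : Real.exp (-(N * t)) ≤ I0 := by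
    have := integral_mono (integrable_const _) hint_ρ hρge
    simpa using this
  have hI0pos : 0 < I0 := (Real.exp_pos _).trans_le hI0
  have hJ : |J| ≤ M := by
    have h1 : |J| ≤ ∫ γ, |g γ| ∂P := abs_integral_le_integral_abs
    have h2 : ∫ γ, |g γ| ∂P ≤ ∫ _γ, M ∂P := integral_mono hint_g.abs (integrable_const M) hM
    have h3 : ∫ _γ, M ∂P = M := by simp
    linarith
  -- `E|ρ - 1|`
  have hE : ∫ γ, |ρ γ - 1| ∂P ≤ (Real.exp (L * t) - 1) + Real.exp (N * t) * (P B).toReal := by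
    have hmeasB : MeasurableSet B := MeasurableSpace.measurableSet_top
    have hint_ind : Integrable (fun γ => B.indicator (1 : DomainSAW Ω δ a b → ℝ) γ) P :=
      (integrable_const (1 : ℝ)).indicator hmeasB
    have hint_rhs : Integrable (fun γ => (Real.exp (L * t) - 1) + Real.exp (N * t) * B.indicator 1 γ) P :=
      (integrable_const _).add (hint_ind.const_mul _)
    have h := integral_mono hint_ρ1 hint_rhs hρ1
    have e : ∫ γ, ((Real.exp (L * t) - 1) + Real.exp (N * t) * B.indicator 1 γ) ∂P =
        (Real.exp (L * t) - 1) + Real.exp (N * t) * (P B).toReal := by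
      rw [integral_add (integrable_const _) (hint_ind.const_mul _), integral_const_mul,
        integral_indicator_one hmeasB, measureReal_def]
      simp
    linarith
  -- the algebra: `∫ g dP_y - J = (I1 - J I0)/I0`, `|I1 - J I0| ≤ 2M E|ρ - 1|`
  have hy_int : ∫ γ, g γ ∂lawAt y Ω δ a b = I1 / I0 := integral_lawAt_eq_div hx hy hP hN g
  have hkey : I1 - J * I0 = ∫ γ, (ρ γ - 1) * g γ ∂P - J * ∫ γ, (ρ γ - 1) ∂P := by
    have e1 : ∫ γ, (ρ γ - 1) * g γ ∂P = I1 - J := by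
      have : (fun γ => (ρ γ - 1) * g γ) = fun γ => ρ γ * g γ - g γ := by ext γ; ring
      rw [this, integral_sub hint_ρg hint_g]
    have e2 : ∫ γ, (ρ γ - 1) ∂P = I0 - 1 := by
      rw [integral_sub hint_ρ (integrable_const 1)]
      simp [hI0def]
    rw [e1, e2]; ring
  have hb1 : |∫ γ, (ρ γ - 1) * g γ ∂P| ≤ M * ∫ γ, |ρ γ - 1| ∂P := by
    calc |∫ γ, (ρ γ - 1) * g γ ∂P| ≤ ∫ γ, |(ρ γ - 1) * g γ| ∂P := abs_integral_le_integral_abs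
      _ ≤ ∫ γ, M * |ρ γ - 1| ∂P := by
          refine integral_mono hint_d.abs (hint_ρ1.const_mul M) fun γ => ?_
          show |(ρ γ - 1) * g γ| ≤ M * |ρ γ - 1|
          rw [abs_mul, mul_comm]
          exact mul_le_mul_of_nonneg_right (hM γ) (abs_nonneg _)
      _ = M * ∫ γ, |ρ γ - 1| ∂P := integral_const_mul _ _
  have hb2 : |∫ γ, (ρ γ - 1) ∂P| ≤ ∫ γ, |ρ γ - 1| ∂P := abs_integral_le_integral_abs
  have hdiff : |I1 - J * I0| ≤ 2 * M * ∫ γ, |ρ γ - 1| ∂P := by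
    rw [hkey]
    have hE0 : 0 ≤ ∫ γ, |ρ γ - 1| ∂P := integral_nonneg fun γ => abs_nonneg _
    calc |∫ γ, (ρ γ - 1) * g γ ∂P - J * ∫ γ, (ρ γ - 1) ∂P|
        ≤ |∫ γ, (ρ γ - 1) * g γ ∂P| + |J * ∫ γ, (ρ γ - 1) ∂P| := abs_sub _ _
      _ ≤ M * ∫ γ, |ρ γ - 1| ∂P + M * ∫ γ, |ρ γ - 1| ∂P := by
          refine add_le_add hb1 ?_
          rw [abs_mul]
          exact mul_le_mul hJ hb2 (abs_nonneg _) hM0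
      _ = 2 * M * ∫ γ, |ρ γ - 1| ∂P := by ring
  -- conclusion
  rw [hy_int]
  have e : I1 / I0 - J = (I1 - J * I0) / I0 := by field_simp
  rw [e, abs_div, abs_of_pos hI0pos, div_le_iff₀ hI0pos]
  calc |I1 - J * I0| ≤ 2 * M * ∫ γ, |ρ γ - 1| ∂P := hdiff
    _ ≤ 2 * M * ((Real.exp (L * t) - 1) + Real.exp (N * t) * (P B).toReal) :=
        mul_le_mul_of_nonneg_left hE (by positivity)
    _ = 2 * M * Real.exp (N * t) * ((Real.exp (L * t) - 1) + Real.exp (N * t) * (P B).toReal) *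
          Real.exp (-(N * t)) := by rw [Real.exp_neg]; field_simp
    _ ≤ 2 * M * Real.exp (N * t) * ((Real.exp (L * t) - 1) + Real.exp (N * t) * (P B).toReal) * I0 :=
        mul_le_mul_of_nonneg_left hI0 hRHS0

end Integrals

/-! ### Volume-close schedules: `|X(δ) - x_c|, |Y(δ) - x_c| ≤ C δ²` and a zero-density input -/

section Schedule

/-- `log` is `m⁻¹`-Lipschitz on `[m, ∞)`: `|log y - log x| ≤ |y - x|/m` for `m ≤ x, y`, `m > 0`.
[folklore] -/
theorem abs_log_sub_log_le_div {m x y : ℝ} (hm : 0 < m) (hx : m ≤ x) (hy : m ≤ y) :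
    |Real.log y - Real.log x| ≤ |y - x| / m := by
  have hx0 : 0 < x := hm.trans_le hx
  have hy0 : 0 < y := hm.trans_le hy
  rw [abs_sub_le_iff]
  constructor
  · have h := Real.log_le_sub_one_of_pos (div_pos hy0 hx0)
    rw [Real.log_div hy0.ne' hx0.ne'] at h
    calc Real.log y - Real.log x ≤ y / x - 1 := h
      _ = (y - x) / x := by field_simp
      _ ≤ |y - x| / x := div_le_div_of_nonneg_right (le_abs_self _) hx0.le
      _ ≤ |y - x| / m := div_le_div_of_nonneg_left (abs_nonneg _) hm hx
  · have h := Real.log_le_sub_one_of_pos (div_pos hx0 hy0)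
    rw [Real.log_div hx0.ne' hy0.ne'] at h
    calc Real.log x - Real.log y ≤ x / y - 1 := h
      _ = (x - y) / y := by field_simp
      _ ≤ |y - x| / y :=
          div_le_div_of_nonneg_right (by rw [abs_sub_comm]; exact le_abs_self _) hy0.le
      _ ≤ |y - x| / m := div_le_div_of_nonneg_left (abs_nonneg _) hm hy

/-- **Bookkeeping along two volume schedules.** If `|X(δ) - x_c|, |Y(δ) - x_c| ≤ C δ²` for
small `δ` and `Ω ⊆ B̄(0, R)`, then for small `δ`: both fugacities are positive, every SAW of
`Ω_δ` has at most `N_δ = (2⌈R/δ⌉ + 1)²` steps, `|log Y(δ) - log X(δ)| ≤ 4C δ²/x_c`, and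
`N_δ · |log Y(δ) - log X(δ)| ≤ (2R+3)² · 4C/x_c` is BOUNDED. [folklore] -/
theorem eventually_volumeClose_bounds {X Y : ℝ → ℝ} {C : ℝ}
    (hXc : ∀ᶠ δ in 𝓝[>] (0 : ℝ), |X δ - criticalFugacity| ≤ C * δ ^ 2)
    (hYc : ∀ᶠ δ in 𝓝[>] (0 : ℝ), |Y δ - criticalFugacity| ≤ C * δ ^ 2)
    {Ω : Set ℂ} {R : ℝ} (hR0 : 0 ≤ R) (hR : Ω ⊆ closedBall 0 R) (hΩ : Bornology.IsBounded Ω)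
    (a b : ℝ → Site 2) :
    ∀ᶠ δ in 𝓝[>] (0 : ℝ), 0 < δ ∧ 0 < X δ ∧ 0 < Y δ ∧
      (∀ γ : DomainSAW Ω δ (a δ) (b δ), γ.length ≤ (2 * ⌈R / δ⌉₊ + 1) ^ 2) ∧
      (((2 * ⌈R / δ⌉₊ + 1) ^ 2 : ℕ) : ℝ) * |Real.log (Y δ) - Real.log (X δ)| ≤
        (2 * R + 3) ^ 2 * (4 * C / criticalFugacity) ∧
      |Real.log (Y δ) - Real.log (X δ)| ≤ 4 * C * δ ^ 2 / criticalFugacity := by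
  obtain ⟨hxc, -⟩ := criticalFugacity_pos_lt_one'
  -- basic eventualities: `δ ∈ (0,1)`, `C δ² ≤ x_c/4`
  have hδsmall : ∀ᶠ δ in 𝓝[>] (0 : ℝ), 0 < δ ∧ δ < 1 ∧ C * δ ^ 2 ≤ criticalFugacity / 4 := by
    have h1 : Tendsto (fun δ : ℝ => C * δ ^ 2) (𝓝[>] 0) (𝓝 (C * 0 ^ 2)) :=
      ((continuous_const.mul (continuous_pow 2)).tendsto 0).mono_left nhdsWithin_le_nhds
    rw [zero_pow two_ne_zero, mul_zero] at h1
    have h2 := h1.eventually (Iic_mem_nhds (show (0 : ℝ) < criticalFugacity / 4 by positivity))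
    filter_upwards [Ioo_mem_nhdsGT (zero_lt_one' ℝ), h2] with δ hδ hδ2
    exact ⟨hδ.1, hδ.2, hδ2⟩
  filter_upwards [hδsmall, hXc, hYc] with δ hδ hXδ hYδ
  obtain ⟨hδ0, hδ1, hCδ⟩ := hδ
  -- positivity and closeness of the two fugacities
  have hX2 : criticalFugacity / 2 ≤ X δ := by
    have := neg_le_of_abs_le hXδ; linarith
  have hY2 : criticalFugacity / 2 ≤ Y δ := by
    have := neg_le_of_abs_le hYδ; linarith
  have hXpos : 0 < X δ := by linarith
  have hYpos : 0 < Y δ := by linarith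
  have hYX : |Y δ - X δ| ≤ 2 * C * δ ^ 2 := by
    calc |Y δ - X δ| = |(Y δ - criticalFugacity) - (X δ - criticalFugacity)| := by ring_nf
      _ ≤ |Y δ - criticalFugacity| + |X δ - criticalFugacity| := abs_sub _ _
      _ ≤ 2 * C * δ ^ 2 := by linarith
  set t := |Real.log (Y δ) - Real.log (X δ)| with htdef
  have ht0 : 0 ≤ t := abs_nonneg _
  have ht : t ≤ 4 * C * δ ^ 2 / criticalFugacity := by
    have h := abs_log_sub_log_le_div (by positivity : 0 < criticalFugacity / 2) hX2 hY2
    calc t ≤ |Y δ - X δ| / (criticalFugacity / 2) := h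
      _ ≤ 2 * C * δ ^ 2 / (criticalFugacity / 2) := div_le_div_of_nonneg_right hYX (by positivity)
      _ = 4 * C * δ ^ 2 / criticalFugacity := by field_simp; ring
  -- lengths are at most `N = (2⌈R/δ⌉+1)² ≤ (2R+3)²/δ²`
  set N : ℕ := (2 * ⌈R / δ⌉₊ + 1) ^ 2 with hN
  have hlen : ∀ γ : DomainSAW Ω δ (a δ) (b δ), γ.length ≤ N := fun γ =>
    (length_le_ncard_meshDomain (meshDomain_finite hΩ hδ0) γ).trans (ncard_meshDomain_le hR hδ0)
  have hNle : (N : ℝ) ≤ (2 * R + 3) ^ 2 / δ ^ 2 := by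
    rw [hN]
    push_cast
    have h3 : ((⌈R / δ⌉₊ : ℕ) : ℝ) < R / δ + 1 := Nat.ceil_lt_add_one (by positivity)
    have h4 : (2 * ((⌈R / δ⌉₊ : ℕ) : ℝ) + 1) ≤ (2 * R + 3) / δ := by
      rw [le_div_iff₀ hδ0]
      have : R / δ * δ = R := div_mul_cancel₀ R hδ0.ne'
      nlinarith
    have h5 : (0 : ℝ) ≤ 2 * ((⌈R / δ⌉₊ : ℕ) : ℝ) + 1 := by positivity
    calc (2 * ((⌈R / δ⌉₊ : ℕ) : ℝ) + 1) ^ 2 ≤ ((2 * R + 3) / δ) ^ 2 := pow_le_pow_left₀ h5 h4 2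
      _ = (2 * R + 3) ^ 2 / δ ^ 2 := by rw [div_pow]
  have hNt : (N : ℝ) * t ≤ (2 * R + 3) ^ 2 * (4 * C / criticalFugacity) := by
    calc (N : ℝ) * t ≤ (2 * R + 3) ^ 2 / δ ^ 2 * (4 * C * δ ^ 2 / criticalFugacity) :=
          mul_le_mul hNle ht ht0 (by positivity)
      _ = (2 * R + 3) ^ 2 * (4 * C / criticalFugacity) := by field_simp
  exact ⟨hδ0, hXpos, hYpos, hlen, by exact_mod_cast hNt, ht⟩

/-- **Transfer across a volume window.** Let `X, Y` be fugacity schedules with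
`|X(δ) - x_c|, |Y(δ) - x_c| ≤ C δ²` for small `δ`, `Ω` a bounded domain with endpoints `a δ, b δ`,
and suppose the fugacity-`X(δ)` laws have ZERO DENSITY: `P_{X(δ),δ}[δ²|γ_δ| ≥ ρ] → 0` for every
`ρ > 0`. Then for every uniformly bounded family of test functions
`∫ g dP_{Y(δ),δ} - ∫ g dP_{X(δ),δ} → 0`. Indeed `|Ω_δ| · |log Y - log X| = O(δ⁻²) · O(δ²)` stays
BOUNDED (not small, as it is along the sub-volume schedules of `…Narrow`), while on the walks with
`δ²|γ_δ| < ρ` the tilt `(Y/X)^{|γ|}` is within `e^{O(ρ)} - 1` of `1`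
(`abs_integral_lawAt_sub_le_of_length`); let `δ → 0`, then `ρ → 0`. [folklore] -/
theorem tendsto_integral_lawAt_sub_of_density {X Y : ℝ → ℝ} {C : ℝ}
    (hXc : ∀ᶠ δ in 𝓝[>] (0 : ℝ), |X δ - criticalFugacity| ≤ C * δ ^ 2)
    (hYc : ∀ᶠ δ in 𝓝[>] (0 : ℝ), |Y δ - criticalFugacity| ≤ C * δ ^ 2)
    {Ω : Set ℂ} (hΩ : Bornology.IsBounded Ω) (a b : ℝ → Site 2)
    (hdens : ∀ ρ : ℝ, 0 < ρ → Tendsto (fun δ => lawAt (X δ) Ω δ (a δ) (b δ)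
        {γ | ρ ≤ δ ^ 2 * γ.length}) (𝓝[>] 0) (𝓝 0))
    (g : ∀ δ : ℝ, DomainSAW Ω δ (a δ) (b δ) → ℝ) {M : ℝ} (hM0 : 0 ≤ M) (hM : ∀ δ γ, |g δ γ| ≤ M) :
    Tendsto (fun δ => ∫ γ, g δ γ ∂lawAt (Y δ) Ω δ (a δ) (b δ) - ∫ γ, g δ γ ∂lawAt (X δ) Ω δ (a δ) (b δ))
      (𝓝[>] 0) (𝓝 0) := by
  obtain ⟨hxc, -⟩ := criticalFugacity_pos_lt_one'
  obtain ⟨R, hR0, hR⟩ : ∃ R, 0 ≤ R ∧ Ω ⊆ closedBall 0 R := by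
    obtain ⟨R, hR⟩ := (Metric.isBounded_iff_subset_closedBall (0 : ℂ)).1 hΩ
    exact ⟨max R 0, le_max_right _ _, hR.trans (closedBall_subset_closedBall (le_max_left _ _))⟩
  set K₁ : ℝ := (2 * R + 3) ^ 2 * (4 * C / criticalFugacity) with hK₁
  -- the pointwise bound, eventually, for each `ρ > 0`
  have hbound : ∀ ρ : ℝ, 0 < ρ → ∀ᶠ δ in 𝓝[>] (0 : ℝ),
      |∫ γ, g δ γ ∂lawAt (Y δ) Ω δ (a δ) (b δ) - ∫ γ, g δ γ ∂lawAt (X δ) Ω δ (a δ) (b δ)| ≤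
        2 * M * Real.exp K₁ * ((Real.exp (4 * C * ρ / criticalFugacity) - 1) +
          Real.exp K₁ * (lawAt (X δ) Ω δ (a δ) (b δ) {γ | ρ ≤ δ ^ 2 * γ.length}).toReal) := by
    intro ρ hρ
    filter_upwards [eventually_volumeClose_bounds hXc hYc hR0 hR hΩ a b] with δ hδ
    obtain ⟨hδ0, hXpos, hYpos, hlen, hNt, ht⟩ := hδ
    set t := |Real.log (Y δ) - Real.log (X δ)| with htdef
    set N : ℕ := (2 * ⌈R / δ⌉₊ + 1) ^ 2 with hN
    have hLt : ρ / δ ^ 2 * t ≤ 4 * C * ρ / criticalFugacity := by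
      calc ρ / δ ^ 2 * t ≤ ρ / δ ^ 2 * (4 * C * δ ^ 2 / criticalFugacity) :=
            mul_le_mul_of_nonneg_left ht (by positivity)
        _ = 4 * C * ρ / criticalFugacity := by field_simp
    -- the abstract inequality
    have key := abs_integral_lawAt_sub_le_of_length (Ω := Ω) (δ := δ) (a := a δ) (b := b δ)
      hXpos hYpos hlen (L := ρ / δ ^ 2) (by positivity) (g δ) hM0 (hM δ)
    have hset : {γ : DomainSAW Ω δ (a δ) (b δ) | ρ / δ ^ 2 ≤ (γ.length : ℝ)} =
        {γ | ρ ≤ δ ^ 2 * γ.length} := by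
      ext γ; simp only [mem_setOf_eq]; rw [div_le_iff₀ (pow_pos hδ0 2), mul_comm]
    rw [hset] at key
    refine key.trans ?_
    -- monotonicity in `N t ≤ K₁` and `L t ≤ 4Cρ/x_c`
    set p : ℝ := (lawAt (X δ) Ω δ (a δ) (b δ) {γ | ρ ≤ δ ^ 2 * γ.length}).toReal with hp
    have hp0 : 0 ≤ p := ENNReal.toReal_nonneg
    have e1 : Real.exp (N * t) ≤ Real.exp K₁ := Real.exp_le_exp.2 hNt
    have e2 : Real.exp (ρ / δ ^ 2 * t) - 1 ≤ Real.exp (4 * C * ρ / criticalFugacity) - 1 :=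
      sub_le_sub_right (Real.exp_le_exp.2 hLt) 1
    have hL1 : 0 ≤ Real.exp (ρ / δ ^ 2 * t) - 1 := by
      have := Real.one_le_exp (by positivity : 0 ≤ ρ / δ ^ 2 * t); linarith
    have s1 : (Real.exp (ρ / δ ^ 2 * t) - 1) + Real.exp (N * t) * p ≤
        (Real.exp (4 * C * ρ / criticalFugacity) - 1) + Real.exp K₁ * p :=
      add_le_add e2 (mul_le_mul_of_nonneg_right e1 hp0)
    have s2 : Real.exp (N * t) * ((Real.exp (ρ / δ ^ 2 * t) - 1) + Real.exp (N * t) * p) ≤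
        Real.exp K₁ * ((Real.exp (4 * C * ρ / criticalFugacity) - 1) + Real.exp K₁ * p) :=
      mul_le_mul e1 s1 (by positivity) (Real.exp_pos _).le
    calc 2 * M * Real.exp (N * t) * ((Real.exp (ρ / δ ^ 2 * t) - 1) + Real.exp (N * t) * p)
        = 2 * M * (Real.exp (N * t) * ((Real.exp (ρ / δ ^ 2 * t) - 1) + Real.exp (N * t) * p)) := by
          ring
      _ ≤ 2 * M * (Real.exp K₁ * ((Real.exp (4 * C * ρ / criticalFugacity) - 1) + Real.exp K₁ * p)) :=
          mul_le_mul_of_nonneg_left s2 (by positivity)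
      _ = _ := by ring
  -- the `ε`-argument: first `δ → 0`, then `ρ → 0`
  rw [Metric.tendsto_nhds]
  intro ε hε
  have hcont : Tendsto (fun u : ℝ => 2 * M * Real.exp K₁ * (Real.exp (4 * C * u / criticalFugacity) - 1))
      (𝓝[>] 0) (𝓝 0) := by
    have hc : Continuous fun u : ℝ => 2 * M * Real.exp K₁ * (Real.exp (4 * C * u / criticalFugacity) - 1) := by
      fun_prop
    have h := hc.tendsto 0
    simp only [mul_zero, zero_div, Real.exp_zero, sub_self] at h
    exact h.mono_left nhdsWithin_le_nhds
  obtain ⟨ρ, hρ, hρε⟩ : ∃ ρ : ℝ, 0 < ρ ∧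
      2 * M * Real.exp K₁ * (Real.exp (4 * C * ρ / criticalFugacity) - 1) < ε / 2 := by
    obtain ⟨ρ, hρ1, hρ2⟩ := ((hcont.eventually (Iio_mem_nhds (half_pos hε))).and self_mem_nhdsWithin).exists
    exact ⟨ρ, hρ2, hρ1⟩
  have htail : ∀ᶠ δ in 𝓝[>] (0 : ℝ), 2 * M * Real.exp K₁ * (Real.exp K₁ *
      (lawAt (X δ) Ω δ (a δ) (b δ) {γ | ρ ≤ δ ^ 2 * γ.length}).toReal) < ε / 2 := by
    have h1 := (ENNReal.tendsto_toReal ENNReal.zero_ne_top).comp (hdens ρ hρ)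
    rw [ENNReal.toReal_zero] at h1
    have h2 : Tendsto (fun δ => 2 * M * Real.exp K₁ * (Real.exp K₁ *
        (lawAt (X δ) Ω δ (a δ) (b δ) {γ | ρ ≤ δ ^ 2 * γ.length}).toReal)) (𝓝[>] 0) (𝓝 0) := by
      have := (h1.const_mul (Real.exp K₁)).const_mul (2 * M * Real.exp K₁)
      simpa using this
    exact h2.eventually (Iio_mem_nhds (half_pos hε))
  filter_upwards [hbound ρ hρ, htail] with δ hδ hδ'
  rw [Real.dist_eq, sub_zero]
  calc |∫ γ, g δ γ ∂lawAt (Y δ) Ω δ (a δ) (b δ) - ∫ γ, g δ γ ∂lawAt (X δ) Ω δ (a δ) (b δ)|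
      ≤ 2 * M * Real.exp K₁ * ((Real.exp (4 * C * ρ / criticalFugacity) - 1) +
          Real.exp K₁ * (lawAt (X δ) Ω δ (a δ) (b δ) {γ | ρ ≤ δ ^ 2 * γ.length}).toReal) := hδ
    _ = 2 * M * Real.exp K₁ * (Real.exp (4 * C * ρ / criticalFugacity) - 1) +
          2 * M * Real.exp K₁ * (Real.exp K₁ *
            (lawAt (X δ) Ω δ (a δ) (b δ) {γ | ρ ≤ δ ^ 2 * γ.length}).toReal) := by ring
    _ < ε / 2 + ε / 2 := add_lt_add hρε hδ'
    _ = ε := add_halves ε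

/-- **Along volume-close schedules the laws dominate each other by a FIXED constant**:
`P_{Y(δ),δ} ≤ K · P_{X(δ),δ}` for small `δ`, `K = e^{2(2R+3)²·4C/x_c} < ∞` (two-sided weight
domination `(Y/X)^{|γ|}, (X/Y)^{|γ|} ≤ e^{N_δ t_δ}` and `…Narrow`'s `lawAt_le_smul_lawAt`). So every
conclusion of the form "`P_δ[E_δ] → 0`" or "`→ 1`" — weak space-filling or its negation
(Problem 10), simplicity or dimension bounds of limit traces read through closed-set
portmanteau — is the same along all volume schedules; the gen-9 bookkeeping remark of the
catalogue entry, as a declaration. [folklore] -/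
theorem exists_eventually_lawAt_le_smul_of_volumeClose {X Y : ℝ → ℝ} {C : ℝ}
    (hXc : ∀ᶠ δ in 𝓝[>] (0 : ℝ), |X δ - criticalFugacity| ≤ C * δ ^ 2)
    (hYc : ∀ᶠ δ in 𝓝[>] (0 : ℝ), |Y δ - criticalFugacity| ≤ C * δ ^ 2)
    {Ω : Set ℂ} (hΩ : Bornology.IsBounded Ω) (a b : ℝ → Site 2) :
    ∃ K : ℝ≥0∞, K ≠ ∞ ∧ ∀ᶠ δ in 𝓝[>] (0 : ℝ),
      lawAt (Y δ) Ω δ (a δ) (b δ) ≤ K • lawAt (X δ) Ω δ (a δ) (b δ) := by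
  obtain ⟨R, hR0, hR⟩ : ∃ R, 0 ≤ R ∧ Ω ⊆ closedBall 0 R := by
    obtain ⟨R, hR⟩ := (Metric.isBounded_iff_subset_closedBall (0 : ℂ)).1 hΩ
    exact ⟨max R 0, le_max_right _ _, hR.trans (closedBall_subset_closedBall (le_max_left _ _))⟩
  set K₁ : ℝ := (2 * R + 3) ^ 2 * (4 * C / criticalFugacity) with hK₁
  set K : ℝ≥0∞ := ENNReal.ofReal (Real.exp K₁) with hK
  refine ⟨K * K, ENNReal.mul_ne_top ENNReal.ofReal_ne_top ENNReal.ofReal_ne_top, ?_⟩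
  -- monotonicity of `c • μ` in `c`
  have mono : ∀ {c c' : ℝ≥0∞} {δ : ℝ} {u v : Site 2} {μ ν : Measure (DomainSAW Ω δ u v)},
      μ ≤ c • ν → c ≤ c' → μ ≤ c' • ν := fun h hc =>
    Measure.le_iff'.2 fun s => (Measure.le_iff'.1 h s).trans (by
      rw [Measure.smul_apply, Measure.smul_apply, smul_eq_mul, smul_eq_mul]
      exact mul_le_mul' hc le_rfl)
  filter_upwards [eventually_volumeClose_bounds hXc hYc hR0 hR hΩ a b] with δ hδ
  obtain ⟨hδ0, hXpos, hYpos, hlen, hNt, -⟩ := hδ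
  have h1 := weightAt_le_smul_weightAt (Ω := Ω) (δ := δ) (a := a δ) (b := b δ) hXpos hYpos hlen
  have h2 := weightAt_le_smul_weightAt (Ω := Ω) (δ := δ) (a := a δ) (b := b δ) hYpos hXpos hlen
  rw [abs_sub_comm] at h2
  have hle : ENNReal.ofReal (Real.exp ((((2 * ⌈R / δ⌉₊ + 1) ^ 2 : ℕ) : ℝ) *
      |Real.log (Y δ) - Real.log (X δ)|)) ≤ K :=
    ENNReal.ofReal_le_ofReal (Real.exp_le_exp.2 hNt)
  exact lawAt_le_smul_lawAt ENNReal.ofReal_ne_top (mono h1 hle) (mono h2 hle)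

/-- **Vanishing probabilities transfer across volume windows**: if `P_{X(δ),δ}[E_δ] → 0` then
`P_{Y(δ),δ}[E_δ] → 0`, for any events `E_δ`. [folklore] -/
theorem tendsto_lawAt_zero_of_volumeClose {X Y : ℝ → ℝ} {C : ℝ}
    (hXc : ∀ᶠ δ in 𝓝[>] (0 : ℝ), |X δ - criticalFugacity| ≤ C * δ ^ 2)
    (hYc : ∀ᶠ δ in 𝓝[>] (0 : ℝ), |Y δ - criticalFugacity| ≤ C * δ ^ 2)
    {Ω : Set ℂ} (hΩ : Bornology.IsBounded Ω) (a b : ℝ → Site 2)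
    {E : ∀ δ : ℝ, Set (DomainSAW Ω δ (a δ) (b δ))}
    (h : Tendsto (fun δ => lawAt (X δ) Ω δ (a δ) (b δ) (E δ)) (𝓝[>] 0) (𝓝 0)) :
    Tendsto (fun δ => lawAt (Y δ) Ω δ (a δ) (b δ) (E δ)) (𝓝[>] 0) (𝓝 0) := by
  obtain ⟨K, hK, hle⟩ := exists_eventually_lawAt_le_smul_of_volumeClose hXc hYc hΩ a b
  have hup : Tendsto (fun δ => K * lawAt (X δ) Ω δ (a δ) (b δ) (E δ)) (𝓝[>] 0) (𝓝 0) := by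
    have := ENNReal.Tendsto.const_mul h (Or.inr hK)
    rwa [mul_zero] at this
  refine tendsto_of_tendsto_of_tendsto_of_le_of_le' tendsto_const_nhds hup
    (Eventually.of_forall fun _ => zero_le) ?_
  filter_upwards [hle] with δ hδ
  have := Measure.le_iff'.1 hδ (E δ)
  rwa [Measure.smul_apply, smul_eq_mul] at this

/-- **The weak space-filling property is blind to volume windows**: along two volume schedules
the fugacity-`X(δ)` laws are weakly space-filling iff the fugacity-`Y(δ)` laws are. In
particular Problem 10 (the critical walk is not weakly space-filling) is the same statement at
`x_c` and at `x_c + s δ²`, any real `s`. [cite: DuminilCopinKozmaYadin2014, §1 (When x > 1/μ) and Problem 10] -/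
theorem isSpaceFillingLaws_iff_of_volumeClose {X Y : ℝ → ℝ} {C : ℝ}
    (hXc : ∀ᶠ δ in 𝓝[>] (0 : ℝ), |X δ - criticalFugacity| ≤ C * δ ^ 2)
    (hYc : ∀ᶠ δ in 𝓝[>] (0 : ℝ), |Y δ - criticalFugacity| ≤ C * δ ^ 2)
    {Ω : Set ℂ} (hΩ : Bornology.IsBounded Ω) (A B : ℝ → Site 2) :
    IsSpaceFillingLaws Ω A B (fun δ => lawAt (X δ) Ω δ (A δ) (B δ)) ↔
      IsSpaceFillingLaws Ω A B (fun δ => lawAt (Y δ) Ω δ (A δ) (B δ)) :=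
  ⟨fun h U hU hUΩ hne => tendsto_lawAt_zero_of_volumeClose hXc hYc hΩ A B (h U hU hUΩ hne),
    fun h U hU hUΩ hne => tendsto_lawAt_zero_of_volumeClose hYc hXc hΩ A B (h U hU hUΩ hne)⟩

/-- **Problem 10 along `x_c + s δ²`**: in a bounded domain the fugacity-`x_c + s δ²` walks are
weakly space-filling iff the critical walks are (`s` real, either sign). [cite: DuminilCopinKozmaYadin2014, Problem 10] -/
theorem isSpaceFillingFamily_add_mul_sq_iff (s : ℝ) {Ω : Set ℂ} (hΩ : Bornology.IsBounded Ω)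
    (A B : ℝ → Site 2) :
    IsSpaceFillingLaws Ω A B (fun δ => lawAt (criticalFugacity + s * δ ^ 2) Ω δ (A δ) (B δ)) ↔
      IsSpaceFillingFamily criticalFugacity Ω A B := by
  rw [← isSpaceFillingLaws_lawAt_iff]
  refine isSpaceFillingLaws_iff_of_volumeClose (C := |s|) (Eventually.of_forall fun δ => ?_)
    (Eventually.of_forall fun δ => ?_) hΩ A B
  · rw [add_sub_cancel_left, abs_mul, abs_of_nonneg (sq_nonneg δ)]
  · rw [sub_self, abs_zero]; positivity

end Schedule

/-! ### SLE limits transfer across volume windows -/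

section SLE

variable {κ : ℝ≥0} {D : DobrushinDomain} {A B : ℝ → Site 2}

/-- **An SLE_κ limit (`0 < κ ≤ 4`) passes between volume-close fugacity schedules.** If the
fugacity-`X(δ)` SAW of `(Ω_δ; A δ, B δ)` converges in law to chordal SLE_κ in `D` and
`|X - x_c|, |Y - x_c| ≤ C δ²`, then so does the fugacity-`Y(δ)` SAW, to the same curve: the SLE
limit forces zero density of the `X`-walks (`tendsto_measure_density_of_convergesInLawToSLE` of
`…DensityNecessary`, the trace of SLE_κ having zero area [cite: RohdeSchramm2005, Thm 8.1]),
which is the input of `tendsto_integral_lawAt_sub_of_density`. [folklore] -/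
theorem ConvergesInLawToSLE.of_volumeClose (hκ0 : 0 < κ) (hκ4 : κ ≤ 4) {X Y : ℝ → ℝ} {C : ℝ}
    (hXc : ∀ᶠ δ in 𝓝[>] (0 : ℝ), |X δ - criticalFugacity| ≤ C * δ ^ 2)
    (hYc : ∀ᶠ δ in 𝓝[>] (0 : ℝ), |Y δ - criticalFugacity| ≤ C * δ ^ 2)
    (h : ConvergesInLawToSLE κ D (fun δ (γ : DomainSAW D.carrier δ (A δ) (B δ)) => γ.curve)
        (fun δ => lawAt (X δ) D.carrier δ (A δ) (B δ))) :
    ConvergesInLawToSLE κ D (fun δ (γ : DomainSAW D.carrier δ (A δ) (B δ)) => γ.curve)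
        (fun δ => lawAt (Y δ) D.carrier δ (A δ) (B δ)) := by
  have hdens : ∀ ρ : ℝ, 0 < ρ → Tendsto (fun δ => lawAt (X δ) D.carrier δ (A δ) (B δ)
      {γ | ρ ≤ δ ^ 2 * γ.length}) (𝓝[>] 0) (𝓝 0) := fun ρ hρ =>
    tendsto_measure_density_of_convergesInLawToSLE
      (P := fun δ => lawAt (X δ) D.carrier δ (A δ) (B δ)) hκ0 hκ4 h hρ
  obtain ⟨Γ, hΓ, -, hT⟩ := h
  refine ⟨Γ, hΓ, Eventually.of_forall fun δ => (DomainSAW.measurable_of_top _).aemeasurable, fun f => ?_⟩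
  have hdiff := tendsto_integral_lawAt_sub_of_density hXc hYc D.isBounded A B hdens
    (fun δ (γ : DomainSAW D.carrier δ (A δ) (B δ)) => f γ.curve) (norm_nonneg f) fun δ γ => by
      rw [← Real.norm_eq_abs]; exact f.norm_coe_le_norm _
  have := (hT f).add hdiff
  simpa using this

/-- A **volume fugacity schedule**: `X(δ) - x_c = O(δ²)` as `δ → 0⁺` — the perturbation
multiplies the weight of every walk of the `O(δ⁻²)`-site domain `Ω_δ` by a factor bounded above
and below; the boundary case of the sub-volume schedules `o(δ²)` of `…Narrow`
(`IsSubVolumeSchedule`). [folklore] -/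
def IsVolumeSchedule (X : ℝ → ℝ) : Prop :=
  ∃ C : ℝ, ∀ᶠ δ in 𝓝[>] (0 : ℝ), |X δ - criticalFugacity| ≤ C * δ ^ 2

/-- The critical schedule is a volume schedule. [folklore] -/
theorem isVolumeSchedule_const : IsVolumeSchedule fun _ => criticalFugacity :=
  ⟨0, Eventually.of_forall fun δ => by simp⟩

/-- The schedules `x_c + s δ²` (any real `s`) are volume schedules. [folklore] -/
theorem isVolumeSchedule_add_mul_sq (s : ℝ) : IsVolumeSchedule fun δ => criticalFugacity + s * δ ^ 2 :=
  ⟨|s|, Eventually.of_forall fun δ => by rw [add_sub_cancel_left, abs_mul, abs_of_nonneg (sq_nonneg δ)]⟩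

/-- A schedule within a window `w ≤ C δ²` is a volume schedule. [folklore] -/
theorem isVolumeSchedule_of_window {w X : ℝ → ℝ} {C : ℝ}
    (hw : ∀ᶠ δ in 𝓝[>] (0 : ℝ), w δ ≤ C * δ ^ 2)
    (hX : ∀ᶠ δ in 𝓝[>] (0 : ℝ), |X δ - criticalFugacity| ≤ w δ) : IsVolumeSchedule X :=
  ⟨C, by filter_upwards [hw, hX] with δ h₁ h₂ using h₂.trans h₁⟩

/-- Sub-volume schedules (`o(δ²)`) are volume schedules (`O(δ²)`). [folklore] -/
theorem IsSubVolumeSchedule.isVolumeSchedule {X : ℝ → ℝ} (hX : IsSubVolumeSchedule X) :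
    IsVolumeSchedule X := by
  refine ⟨1, ?_⟩
  have h := ((tendsto_zero_iff_abs_tendsto_zero _).1 hX).eventually (Iic_mem_nhds zero_lt_one)
  filter_upwards [h, self_mem_nhdsWithin] with δ hδ hδ0
  have hδ2 : 0 < δ ^ 2 := pow_pos (mem_Ioi.1 hδ0) 2
  have hδ' : |(X δ - criticalFugacity) / δ ^ 2| ≤ 1 := hδ
  rw [abs_div, abs_of_pos hδ2, div_le_iff₀ hδ2] at hδ'
  exact hδ'

/-- The constant in a volume schedule may be taken non-negative. [folklore] -/
theorem IsVolumeSchedule.exists_nonneg {X : ℝ → ℝ} (hX : IsVolumeSchedule X) :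
    ∃ C : ℝ, 0 ≤ C ∧ ∀ᶠ δ in 𝓝[>] (0 : ℝ), |X δ - criticalFugacity| ≤ C * δ ^ 2 := by
  obtain ⟨C, hC⟩ := hX
  refine ⟨max C 0, le_max_right _ _, ?_⟩
  filter_upwards [hC] with δ hδ
  exact hδ.trans (mul_le_mul_of_nonneg_right (le_max_left _ _) (sq_nonneg δ))

/-- **Convergence in law to SLE_κ, `0 < κ ≤ 4`, is the same along every volume schedule as at
`x_c`** (each direction uses the zero density forced by its own SLE limit). The boundary case
`O(δ²)` of `convergesInLawToSLE_along_iff` (`o(δ²)`, `…Narrow`). [folklore] -/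
theorem convergesInLawToSLE_volume_iff (hκ0 : 0 < κ) (hκ4 : κ ≤ 4) {X : ℝ → ℝ} (hX : IsVolumeSchedule X)
    (D : DobrushinDomain) (A B : ℝ → Site 2) :
    ConvergesInLawToSLE κ D (fun δ (γ : DomainSAW D.carrier δ (A δ) (B δ)) => γ.curve)
        (fun δ => lawAt (X δ) D.carrier δ (A δ) (B δ)) ↔
      ConvergesInLawToSLE κ D (fun δ (γ : DomainSAW D.carrier δ (A δ) (B δ)) => γ.curve)
        (fun δ => law D.carrier δ (A δ) (B δ)) := by
  obtain ⟨C, hC, hXc⟩ := hX.exists_nonneg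
  have hcc : ∀ᶠ δ in 𝓝[>] (0 : ℝ), |(fun _ : ℝ => criticalFugacity) δ - criticalFugacity| ≤ C * δ ^ 2 :=
    Eventually.of_forall fun δ => by simpa using mul_nonneg hC (sq_nonneg δ)
  have e : (fun δ => law D.carrier δ (A δ) (B δ)) =
      fun δ => lawAt ((fun _ : ℝ => criticalFugacity) δ) D.carrier δ (A δ) (B δ) := by
    funext δ; exact (lawAt_criticalFugacity _ _ _ _).symm
  rw [e]
  exact ⟨fun h => ConvergesInLawToSLE.of_volumeClose hκ0 hκ4 hXc hcc h,
    fun h => ConvergesInLawToSLE.of_volumeClose hκ0 hκ4 hcc hXc h⟩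

/-- **Along a volume schedule the SLE_{8/3} statement is the sub-problem.** [folklore] -/
theorem sawScalingLimitAlong_iff_of_isVolumeSchedule {X : ℝ → ℝ} (hX : IsVolumeSchedule X) :
    SAWScalingLimitAlong X ↔ SAWScalingLimit :=
  forall₄_congr fun D a b _ => convergesInLawToSLE_volume_iff (by positivity) eight_thirds_le_four hX D a b

/-- **A window inside `C δ²` makes the window-robust strengthening EQUIVALENT to the
sub-problem** (`w ≥ 0` eventually, so that the window contains the critical schedule). [folklore] -/
theorem windowRobustSAWScalingLimit_iff_of_le_sq {w : ℝ → ℝ} {C : ℝ}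
    (hw0 : ∀ᶠ δ in 𝓝[>] (0 : ℝ), 0 ≤ w δ) (hw : ∀ᶠ δ in 𝓝[>] (0 : ℝ), w δ ≤ C * δ ^ 2) :
    WindowRobustSAWScalingLimit w ↔ SAWScalingLimit :=
  ⟨fun h => h.sawScalingLimit hw0,
    fun h _ hX => (sawScalingLimitAlong_iff_of_isVolumeSchedule (isVolumeSchedule_of_window hw hX)).2 h⟩

/-- **The volume windows `w(δ) = C δ²`, `C ≥ 0`, are equivalent to the sub-problem.** [folklore] -/
theorem windowRobustSAWScalingLimit_sq_iff {C : ℝ} (hC : 0 ≤ C) :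
    WindowRobustSAWScalingLimit (fun δ => C * δ ^ 2) ↔ SAWScalingLimit :=
  windowRobustSAWScalingLimit_iff_of_le_sq (Eventually.of_forall fun δ => mul_nonneg hC (sq_nonneg δ))
    (Eventually.of_forall fun _ => le_rfl)

/-- **The sub-problem is invariant under an `O(δ²)` shift of the fugacity**: `SAWScalingLimit`
holds iff the SAW with fugacity `x_c + s δ²` converges to SLE_{8/3} in every Dobrushin domain —
for ANY fixed real `s`, of either sign (a bounded multiple `e^{(s/x_c + o(1)) δ²|γ_δ|}` of the
DENSITY in the Hamiltonian is free). [folklore] -/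
theorem sawScalingLimit_iff_along_add_mul_sq (s : ℝ) :
    SAWScalingLimit ↔ SAWScalingLimitAlong fun δ => criticalFugacity + s * δ ^ 2 :=
  (sawScalingLimitAlong_iff_of_isVolumeSchedule (isVolumeSchedule_add_mul_sq s)).symm

end SLE

end SupercriticalSAW

open SupercriticalSAW

/-- **Barrier `SupercriticalSAWSpaceFillingVolumeWindow`** (nineteenth audit of `…Proofs`,
PROVED below): the lower edge of the near-critical window class of `SupercriticalSAWSpaceFilling`
/ `…Narrow` / `…WindowRate` made exact — fugacity windows of width `O(δ²)` ("volume windows":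
the perturbation changes the weight of every walk of the `O(δ⁻²)`-site domain by a bounded
factor) carry NO obstruction and NO extra content: the window-robust SLE_{8/3} statement along
them is EQUIVALENT to the sub-problem.

BARRIER (structured block, D-0021):
- technique_class: volume-window fugacity robustness (an SLE_{8/3} conclusion asserted along every schedule `X(δ)` with `|X(δ) - x_c| ≤ C δ²`, any fixed `C ≥ 0`; contains the sub-volume class `o(δ²)` of `…Narrow` and the shifted schedules `x_c + s δ²`, `s ∈ ℝ`) — recorded as a barrier entry only to delimit the window class of the parent: this class is FREE [cite: DuminilCopinKozmaYadin2014, Theorem 1]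
- blocks: nothing — on the contrary `SupercriticalSAW.WindowRobustSAWScalingLimit (δ ↦ C δ²) ↔ SAWScalingLimit` for every `C ≥ 0` (`SupercriticalSAW.windowRobustSAWScalingLimit_sq_iff`), `SupercriticalSAW.SAWScalingLimitAlong X ↔ SAWScalingLimit` for every volume schedule (`SupercriticalSAW.sawScalingLimitAlong_iff_of_isVolumeSchedule`), `SAWScalingLimit ↔ SAWScalingLimitAlong (δ ↦ x_c + s δ²)` for every real `s` (`SupercriticalSAW.sawScalingLimit_iff_along_add_mul_sq`), and weak space-filling / Problem 10 is the same statement along any two volume schedules (`SupercriticalSAW.isSpaceFillingLaws_iff_of_volumeClose`, `SupercriticalSAW.isSpaceFillingFamily_add_mul_sq_iff`) — all unconditional (axioms `propext`, `Classical.choice`, `Quot.sound`)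
- because: along two schedules within `C δ²` of `x_c` the number of sites `|Ω_δ| ≤ (2R+3)²/δ²` times `|log Y(δ) - log X(δ)| ≤ 4Cδ²/x_c` is BOUNDED, so the laws dominate each other by a fixed constant (`SupercriticalSAW.exists_eventually_lawAt_le_smul_of_volumeClose`) — which transfers every vanishing-probability conclusion — and, for the SLE identification, the tilt `(Y/X)^{|γ_δ|}` is within `e^{4Cρ/x_c} - 1` of `1` on `{δ²|γ_δ| < ρ}` while `P[δ²|γ_δ| ≥ ρ] → 0` on whichever side converges to an SLE_κ with `κ ≤ 4` (zero area of the trace [cite: RohdeSchramm2005, Thm 8.1], closed-set portmanteau [cite: Billingsley1999, Thm 2.1], `SupercriticalSAW.tendsto_measure_density_of_convergesInLawToSLE`), whence `∫ g dP_{Y(δ)} - ∫ g dP_{X(δ)} → 0` for bounded `g` (`SupercriticalSAW.abs_integral_lawAt_sub_le_of_length`, `SupercriticalSAW.tendsto_integral_lawAt_sub_of_density`)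
- evasions_known: not applicable (free class); what remains undecided between this free class and the blocked class `w(δ) ≥ δ^θ`, `θ < 1/4`, of `…WindowRateQuarter` (part B of this audit; `θ < 1/6` in `…WindowRate`) is `δ² ≪ w(δ) ≲ δ^{1/4}` — for `w(δ)/δ² → ∞` the transfer needs a RATE of zero critical density (`P_{x_c}[|γ_δ| ≥ k/w(δ)]` summably small), which the sub-problem alone does not give and which in substance holds up to the crossover `|x - x_c| ≍ δ^{4/3}` (`ν = 3/4`) [cite: LawlerSchrammWerner2004SAW, Prediction 2], measured lattice-side as the finite-size variable `(β - β_c)L^{4/3}` [cite: BradlyOwczarek2021, Abstract and §3]; on the blocked side the exponent `1/6` is not the printed argument's limit: the Peierls bound of the source is in the site-cardinality of the hole [cite: DuminilCopinKozmaYadin2014, §3 (proof of Theorem 1)] and an avoided macroscopic ball is a hole of `≍ (r/δ)²` sites in one component, which gives `θ < 1/3` from the rate and `θ < 1/4` from the tree's tile mesh threshold (proved in part B, `SupercriticalSAWSpaceFillingWindowRateQuarter_holds`)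
- scope_caveats: bounded domains (every Dobrushin domain), any endpoints, `ℤ²`; the SLE transfer is for `0 < κ ≤ 4` (it uses zero area of the limit trace; for `4 < κ < 8` the same holds in substance by `dim < 2` but the tree's zero-area lemma `SupercriticalSAW.ae_volume_range_eq_zero_of_isSLECurve` is stated for `κ ≤ 4`), the event transfer (`→ 0` probabilities, weak space-filling) for all laws; windows must be `O(δ²)` with a `δ`-independent constant — nothing is claimed for `w(δ)/δ² → ∞` [cite: DuminilCopinKozmaYadin2014, Theorem 1 and Problem 10]
- status: established (proved in the tree: `SupercriticalSAWSpaceFillingVolumeWindow_holds`)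

[cite: DuminilCopinKozmaYadin2014, Theorem 1 and Problem 10] -/
def SupercriticalSAWSpaceFillingVolumeWindow : Prop :=
  (∀ X : ℝ → ℝ, SupercriticalSAW.IsVolumeSchedule X →
      (SupercriticalSAW.SAWScalingLimitAlong X ↔ SAWScalingLimit)) ∧
    ∀ C : ℝ, 0 ≤ C →
      (SupercriticalSAW.WindowRobustSAWScalingLimit (fun δ => C * δ ^ 2) ↔ SAWScalingLimit)

/-- **The volume-window entry holds.** [cite: DuminilCopinKozmaYadin2014, Theorem 1 and Problem 10] -/
theorem SupercriticalSAWSpaceFillingVolumeWindow_holds : SupercriticalSAWSpaceFillingVolumeWindow :=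
  ⟨fun _ hX => sawScalingLimitAlong_iff_of_isVolumeSchedule hX,
    fun _ hC => windowRobustSAWScalingLimit_sq_iff hC⟩

end Literature.Barriers.CriticalPhenomena
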